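/-
Copyright (c) 2026 the pub-hodgecm-mathlib formalisation cell (harness21).  Prover seat hodgecm-mathlib-B-p14 (g42): ENTRY BRICK «WILD QUADRATIC CONDUCTOR»
of the DYADIC road of half A line LH4 (dealer LH4-plan (g3) WORD #25; census F0P3a-p06 (g17) `DUNR-H2-CENSUS.md` §3); 2026-09-02.
-/
import Mathlib.Algebra.CharP.Reduced
import Mathlib.Algebra.CharP.Two
import Literature.NumberTheory.LocalFields.CompleteValuedSquareRootNearOne   -- ★ (W-a) `exists_mul_self_eq_of_valued_sub_one_lt_four` (deep one-units are squares)
import Literature.NumberTheory.Automorphic.AdicCompletionCompact            -- ★ `finite_residueField_adicCompletion` (`𝓀[K_v]` finite)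
import HarnessLib

/-!
# Norms from `K(√u)` near `1` at residue characteristic `2`: the wild conductor bounds `a ≤ 2·ord 2 + 1`, `a ≤ 2·ord 2` (unit `u`), `a = 0` for
# `u ≡ □ (mod 4)`, and the even-depth ladder of the quadratic defect (O'Meara §63A)

Topic `NumberTheory/LocalFields`; namespace `Literature.NumberTheory.LocalFields`.  THEOREMS ONLY (no definition, no instance, no notation, no named fact, no `sorry`);
CM-free; kernel lane `--supports stmt-HodgeConjecture-24833`.  Cell `pub/hodgecm-mathlib` (D-0151), crux H413 = `stmt-HodgeConjecture-24833`; half A line LH4 (closer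
stub `stub_N6ns`), DYADIC pay-down leaf `Cruxes/H413/Lines/F0_P3c_DyadicPaydown.lean`, organs (D-UNR)∕(D-RAM) (PRINT this week; census F0P3a-p06 (g17)
`DUNR-H2-CENSUS.md` OUTCOME B: the in-house wall is the WILD QUADRATIC CONDUCTOR — its mechanisms M3 (transfer-factor exponent), M4 (self-dual cyclic lattice laws),
M6 (Euler–Poincaré relation) all key on it).  This is the ENTRY BRICK of that road (dealer LH4-plan (g3) WORD #25), in the currency of ★ (W-a)
`CompleteValuedSquareRootNearOne`: a field `K` with a valuation `Valued.v : K → ℤᵐ⁰` whose valuation ring `𝒪[K]` is `𝓂[K]`-adically complete.  HONEST LABEL: HC_CM is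
proved only modulo the 7 printed citations (2 remaining named inputs: hLiu418 = stmt-HodgeConjecture-24832, h413 = stmt-HodgeConjecture-24833) until rung 0 closes;
this file is count-neutral and Mathlib-footed (banked for the dyadic semisimple side; it unblocks nothing by itself).

DEFINE-FREE CURRENCY.  «`x` is a norm from `K(√u)`» is the binary-form statement `∃ a b : K, a·a − u·(b·b) = x` (no extension type; `u` may be a square).
«Every residue is a square» (automatic for a FINITE residue field of characteristic `2`, §6) is the binder `hres : ∀ z, v z ≤ 1 → ∃ y, v y ≤ 1 ∧ v(y·y − z) < 1`.
The Artin conductor `a = a(K(√u)∕K)` — the least `m` with `1 + 𝔭^m ⊆ N(K(√u)^×)` — is never defined: each theorem IS an inclusion `{x : v(x − 1) < ∕ ≤ r} ⊆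
N(K(√u)^×)`, i.e. an upper bound on `a`, proved by Hensel's lemma alone (no class field theory).  Write `e = ord_K 2`.
* §0 `exists_valued_lt_one_mul_self_add_mul_eq` — HENSEL KERNEL for the monic `X² + bX − c` at the simple residual root `0` (`v b = 1`, `v c < 1`).
* §1 `exists_sq_sub_mul_sq_eq_mul` (Brahmagupta), `…_eq_one`, `…_eq_mul_self`, `…_eq_neg` (`−u`), `…_eq_inv`, `exists_sq_sub_mul_sq_iff_mul_sq` (`u ↦ u·t²`).
* §2 (W1) `exists_sq_sub_mul_sq_eq_of_valued_sub_one_lt_four` — `v(x − 1) < v 4 ⇒ x ∈ N(K(√u))` for EVERY `u` (`x` is a square, ★ (W-a)): `a ≤ 2e + 1`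
  universally (sharp: `ℚ₂(√2)`).
* §3 (W2) `exists_sq_sub_mul_sq_eq_of_valued_sub_one_le_four` — `v u = 1`, `v(x − 1) ≤ v 4 ⇒ x = a² − u b²` with `a ≡ 1`, `b ≡ 0 (mod 2)` (`x = 1 + 4c`,
  `ū β̄² = −c̄`, `α² + α = c + uβ² ∈ 𝔭`, `a = 1 + 2α`, `b = 2β`): **`1 + 4𝒪 ⊆ N(K(√u))`, `a ≤ 2e` for every UNIT `u`** (sharp: `ℚ₂(√3)`, `ℚ₂(√−1)`).
* §4 (W3) `exists_sq_sub_mul_sq_eq_of_valued_eq_one` — `v(u − 1) ≤ v 4`, `v 2 < 1`, `2 ≠ 0 ⇒` EVERY UNIT is a norm: in the basis `θ = (1 + √u)∕2` the form is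
  `a² + ab − d b²`, `d = (u − 1)∕4`; `d ∈ 𝔭 ⇒ u = r²` (★ (W-a)), hyperbolic; `d ∈ 𝒪^× ⇒ β̄² = x̄∕d̄`, Hensel in `a` (`f′(0) = β` a unit, `x + dβ² ≡ 2x ≡ 0`).
  With §1 this is **the ⇐ half of «`a = 0 ⟺ u ∈ (1 + 4𝒪)·(K^×)²`»** (O'Meara 63:3: the unit of defect `4𝒪` gives the unramified quadratic extension).
* §5 (W4) `exists_valued_mul_sq_sub_one_lt` — THE EVEN-DEPTH LADDER (O'Meara 63:2∕63:5; no completeness): `v(u − 1) = v(y)² < 1` with `v 2 < v y` (depth `2k`,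
  `k < e`) ⇒ `v(u·t² − 1) < v(u − 1)` for a unit `t` (`t = (1 + yγ)⁻¹`, `γ̄² = (u−1)∕y²`; the cross term `2yγ` is deeper BECAUSE `v 2 < v y`).  Iterating, a
  unit's square class is `≥ 4`-deep (§4: `a = 0`) or has an ODD depth `s < 2e` — its quadratic DEFECT `𝔭^s`, where `a = 2e + 1 − s`.
* §6 `exists_valued_mul_self_sub_lt_one_of_finite_residueField` — `hres` from `[Finite 𝓀[K]]` + `v 2 < 1` (Mathlib `isSquare_of_charTwo'`), and (W2)∕(W3) so dressed.
* §7 `…_adicCompletion` — (W2), (W3), (W4) in `F_v` for a number field `F` at a DYADIC place (`v(2) < 1`), hypothesis-free otherwise (★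
  `isAdicComplete_valuedMaximalIdeal_valuedInteger_adicCompletion`, ★ `finite_residueField_adicCompletion`).
NOT HERE (honest scope): the ⇒ half of «`a = 0 ⟺ …`» and the EXACT `a = 2e + 1 − s` need a NON-NORM certificate at odd defect (`[U : N U_{K(√u)}] = 2`, the norm
hyperplane in `U^{(2e−s)}∕U^{(2e+1−s)} ≅ 𝓀` = the dyadic Hilbert symbol, O'Meara 63:10–63:11a, Serre XIV §§3–4) — the sequel brick.

## References
* [Omeara1963] O. T. O'Meara, *Introduction to Quadratic Forms*, Grundlehren 117 (1963), §63A (63:1 Local Square Theorem, 63:1a, 63:2–63:5: the quadratic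
  defect of a dyadic unit, the unit of defect `4𝔬`), §63B (63:9–63:11a: local norms from `F(√α)` at a dyadic spot).
* [Serre1979] J.-P. Serre, *Local Fields*, GTM 67 (1979), Ch. II §4 Prop. 7 (Hensel); Ch. V §3; Ch. XIV §§3–4 (local symbols, `p = 2`); Ch. XV §2 (conductor via `U_K^n`).
* [NeukirchANT1999] J. Neukirch, *Algebraic Number Theory* (1999), Ch. II (4.6) (Hensel), Ch. V §3 (the Hilbert symbol at dyadic places).
-/

set_option autoImplicit false

noncomputable section

open scoped Valued WithZero
open Polynomial NumberField IsDedekindDomain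

namespace Literature.NumberTheory.LocalFields

/-! ## §0 The Hensel kernel: `X² + bX − c`, `b` a unit, `c ∈ 𝔭` -/
section Hensel
variable {K : Type*} [Field K] [Valued K ℤᵐ⁰]
/-- **HENSEL KERNEL.**  In a field `K` with valuation `Valued.v : K → ℤᵐ⁰` and `𝓂[K]`-adically complete valuation ring: if `v b = 1` and `v c < 1` then
`x·x + b·x = c` for some `x` with `v x < 1` — Hensel's lemma (Mathlib `IsAdicComplete.henselianRing`) for the monic `X² + bX − c ∈ 𝒪[K][X]` at the
simple residual root `0` (`f(0) = −c ∈ 𝓂`, `f′(0) = b ∈ 𝒪^×`).  Every residue characteristic; the case `b = 1` is the (W-a) step.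
[cite: Serre1979, Ch. II §4 Prop. 7] [cite: NeukirchANT1999, Ch. II (4.6)] -/
theorem exists_valued_lt_one_mul_self_add_mul_eq [IsAdicComplete 𝓂[K] 𝒪[K]] {b c : K} (hb : Valued.v b = 1) (hc : Valued.v c < 1) :
    ∃ x : K, Valued.v x < 1 ∧ x * x + b * x = c := by
  have hbO : b ∈ 𝒪[K] := (Valuation.mem_integer_iff _ _).2 hb.le
  have hcO : c ∈ 𝒪[K] := (Valuation.mem_integer_iff _ _).2 hc.le
  set bO : 𝒪[K] := ⟨b, hbO⟩ with hbO_def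
  set cO : 𝒪[K] := ⟨c, hcO⟩ with hcO_def
  have hcM : cO ∈ 𝓂[K] := by rw [Valued.maximalIdeal, IsLocalRing.mem_maximalIdeal, mem_nonunits_iff, Valuation.Integer.not_isUnit_iff_valuation_lt_one]; exact hc
  have hbU : IsUnit bO := by rw [(Valuation.integer.integers (Valued.v (R := K))).isUnit_iff_valuation_eq_one]; exact hb
  -- Hensel for the monic `f = X² + (bO·X − cO)` at `a₀ = 0`
  set f : (𝒪[K])[X] := X ^ 2 + (C bO * X - C cO) with hf
  have hdeg : (C bO * X - C cO).degree < 2 := by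
    refine (degree_sub_le _ _).trans_lt (max_lt ?_ ?_)
    · exact (degree_C_mul_X_le _).trans_lt (by exact_mod_cast Nat.one_lt_two)
    · exact degree_C_le.trans_lt (by exact_mod_cast Nat.zero_lt_two)
  have hmonic : f.Monic := by rw [hf]; exact monic_X_pow_add hdeg
  have heval : f.eval 0 = -cO := by
    simp only [hf, eval_add, eval_pow, eval_X, eval_sub, eval_mul, eval_C, ne_eq, OfNat.ofNat_ne_zero, not_false_eq_true, zero_pow,
      mul_zero, zero_sub, zero_add]
  have hderiv : f.derivative.eval 0 = bO := by
    simp only [hf, derivative_add, derivative_X_pow, derivative_sub, derivative_mul, derivative_X, derivative_C, zero_mul, mul_one,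
      zero_add, sub_zero, eval_add, eval_mul, eval_C, eval_pow, eval_X, Nat.cast_ofNat]
    norm_num
  have h₁ : f.eval 0 ∈ 𝓂[K] := by rw [heval]; exact neg_mem hcM
  have h₂ : IsUnit (Ideal.Quotient.mk 𝓂[K] (f.derivative.eval 0)) := by rw [hderiv]; exact hbU.map _
  obtain ⟨x, hxroot, hxM⟩ := HenselianRing.is_henselian (I := 𝓂[K]) f hmonic 0 h₁ h₂
  rw [sub_zero] at hxM
  have hxK : (x : K) ^ 2 + (b * (x : K) - c) = 0 := by
    have h := hxroot
    rw [IsRoot.def, hf, eval_add, eval_pow, eval_X, eval_sub, eval_mul, eval_C, eval_X, eval_C] at h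
    have h' := congrArg (fun z : 𝒪[K] => (z : K)) h
    simpa [hbO_def, hcO_def] using h'
  have hvx : Valued.v (x : K) < 1 := by
    rw [Valued.maximalIdeal, IsLocalRing.mem_maximalIdeal, mem_nonunits_iff, Valuation.Integer.not_isUnit_iff_valuation_lt_one] at hxM
    exact hxM
  exact ⟨x, hvx, by linear_combination hxK⟩
end Hensel

/-! ## §1 The norm form `a·a − u·(b·b)`: algebra (any field) -/
section Algebra
variable {K : Type*} [Field K]
/-- **BRAHMAGUPTA**: norms from `K(√u)` are closed under multiplication — `(a² − ub²)(c² − ud²) = (ac + ubd)² − u(ad + bc)²`.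
[cite: Omeara1963, §63B 63:9–63:11a] -/
theorem exists_sq_sub_mul_sq_eq_mul (u : K) {x y : K} (hx : ∃ a b : K, a * a - u * (b * b) = x) (hy : ∃ a b : K, a * a - u * (b * b) = y) :
    ∃ a b : K, a * a - u * (b * b) = x * y := by
  obtain ⟨a, b, rfl⟩ := hx
  obtain ⟨c, d, rfl⟩ := hy
  exact ⟨a * c + u * (b * d), a * d + b * c, by ring⟩

/-- `1` is a norm from `K(√u)` (`a = 1`, `b = 0`). [cite: Omeara1963, §63B 63:9–63:11a] -/
theorem exists_sq_sub_mul_sq_eq_one (u : K) : ∃ a b : K, a * a - u * (b * b) = 1 :=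
  ⟨1, 0, by ring⟩

/-- Squares are norms from `K(√u)` (`b = 0`). [cite: Omeara1963, §63B 63:9–63:11a] -/
theorem exists_sq_sub_mul_sq_eq_mul_self (u y : K) : ∃ a b : K, a * a - u * (b * b) = y * y :=
  ⟨y, 0, by ring⟩

/-- `−u` is a norm from `K(√u)` (the norm of `√u`: `a = 0`, `b = 1`). [cite: Omeara1963, §63B 63:9–63:11a] -/
theorem exists_sq_sub_mul_sq_eq_neg (u : K) : ∃ a b : K, a * a - u * (b * b) = -u :=
  ⟨0, 1, by ring⟩

/-- The inverse of a norm from `K(√u)` is a norm (`x⁻¹ = x · (x⁻¹)²`). [cite: Omeara1963, §63B 63:9–63:11a] -/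
theorem exists_sq_sub_mul_sq_eq_inv (u : K) {x : K} (hx : ∃ a b : K, a * a - u * (b * b) = x) :
    ∃ a b : K, a * a - u * (b * b) = x⁻¹ := by
  by_cases hx0 : x = 0
  · rw [hx0, inv_zero]
    rwa [hx0] at hx
  · have h := exists_sq_sub_mul_sq_eq_mul u hx (exists_sq_sub_mul_sq_eq_mul_self u x⁻¹)
    rwa [← mul_assoc, mul_inv_cancel₀ hx0, one_mul] at h

/-- **SQUARE-CLASS TRANSPORT**: the norms from `K(√u)` and from `K(√(u·t²))` (`t ≠ 0`) are the same (`b ↦ b·t⁻¹`). [cite: Omeara1963, §63A 63:1–63:5] -/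
theorem exists_sq_sub_mul_sq_iff_mul_sq (u : K) {t : K} (ht : t ≠ 0) (x : K) :
    (∃ a b : K, a * a - u * (b * b) = x) ↔ ∃ a b : K, a * a - u * (t * t) * (b * b) = x := by
  constructor
  · rintro ⟨a, b, rfl⟩
    refine ⟨a, b * t⁻¹, ?_⟩
    field_simp
  · rintro ⟨a, b, rfl⟩
    exact ⟨a, t * b, by ring⟩
end Algebra

/-! ## §2–§5 Norms near `1` in a complete valued field -/
section NearOne
variable {K : Type*} [Field K] [Valued K ℤᵐ⁰]
/-- **(W1) DEEP ONE-UNITS ARE NORMS FROM EVERY `K(√u)`** (`a(K(√u)∕K) ≤ 2·ord 2 + 1` universally): if `v(x − 1) < v 4` then `x = a·a − u·(b·b)` —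
indeed `x = r·r` is a square (★ (W-a) `exists_mul_self_eq_of_valued_sub_one_lt_four`, O'Meara's Local Square Theorem 63:1), `b = 0`.
[cite: Omeara1963, §63A 63:1] [cite: Serre1979, Ch. XIV §4] -/
theorem exists_sq_sub_mul_sq_eq_of_valued_sub_one_lt_four [IsAdicComplete 𝓂[K] 𝒪[K]] (u x : K) (hx : Valued.v (x - 1) < Valued.v (4 : K)) :
    ∃ a b : K, a * a - u * (b * b) = x := by
  obtain ⟨r, hr, -⟩ := exists_mul_self_eq_of_valued_sub_one_lt_four x hx
  exact ⟨r, 0, by rw [mul_zero, mul_zero, sub_zero, hr]⟩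

/-- **(W2) `1 + 4𝒪 ⊆ N(K(√u)^×)` FOR A UNIT `u`** (`a(K(√u)∕K) ≤ 2·ord 2` for every unit `u`; residue field with all residues squares — e.g. finite
of characteristic `2`, §6): if `v u = 1` and `v(x − 1) ≤ v 4` then `x = a·a − u·(b·b)` with `v(a − 1) ≤ v 2`, `v b ≤ v 2`.  Proof: `x = 1 + 4c`
(`c ∈ 𝒪`), `β ∈ 𝒪` with `v(β² + c∕u) < 1` (hres), `α ∈ 𝓂` with `α² + α = c + uβ²` (§0, the right side lies in `𝓂`), `a = 1 + 2α`, `b = 2β`: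
`a² − ub² = 1 + 4(α² + α) − 4uβ² = 1 + 4c`.  (If `4 = 0` in `K` the hypothesis forces `x = 1`.)  Sharp: `ℚ₂(√3)`, `ℚ₂(√−1)` have conductor `2`.
[cite: Omeara1963, §63A 63:2–63:5; §63B 63:11a] [cite: Serre1979, Ch. XV §2] -/
theorem exists_sq_sub_mul_sq_eq_of_valued_sub_one_le_four [IsAdicComplete 𝓂[K] 𝒪[K]]
    (hres : ∀ z : K, Valued.v z ≤ 1 → ∃ y : K, Valued.v y ≤ 1 ∧ Valued.v (y * y - z) < 1)
    {u : K} (hu : Valued.v u = 1) {x : K} (hx : Valued.v (x - 1) ≤ Valued.v (4 : K)) :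
    ∃ a b : K, Valued.v (a - 1) ≤ Valued.v (2 : K) ∧ Valued.v b ≤ Valued.v (2 : K) ∧ a * a - u * (b * b) = x := by
  by_cases h4 : (4 : K) = 0
  · rw [h4, map_zero, le_zero_iff, map_eq_zero, sub_eq_zero] at hx
    exact ⟨1, 0, by rw [sub_self, map_zero]; exact zero_le, by rw [map_zero]; exact zero_le, by rw [hx]; ring⟩
  have h2 : (2 : K) ≠ 0 := fun h2 => h4 (by rw [show (4 : K) = 2 * 2 by norm_num, h2, mul_zero])
  have hv4 : Valued.v (4 : K) ≠ 0 := (Valuation.ne_zero_iff _).2 h4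
  have hu0 : u ≠ 0 := fun h => zero_ne_one (by rw [h, map_zero] at hu; exact hu)
  -- `c := (x − 1)∕4 ∈ 𝒪`
  set c : K := (x - 1) * (4 : K)⁻¹ with hc
  have hc4 : c * 4 = x - 1 := by rw [hc, inv_mul_cancel_right₀ h4]
  have hvc : Valued.v c ≤ 1 := by
    have h := mul_le_mul_left hx (Valued.v (4 : K))⁻¹
    rwa [← map_inv₀, ← map_mul, ← hc, map_inv₀, mul_inv_cancel₀ hv4] at h
  -- `β` with `v(β² + c∕u) < 1`
  obtain ⟨β, hβ1, hβ⟩ := hres (-c * u⁻¹) (by rw [map_mul, Valuation.map_neg, map_inv₀, hu, inv_one, mul_one]; exact hvc)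
  have hy : Valued.v (c + u * (β * β)) < 1 := by
    have hcu : c + u * (β * β) = u * (β * β - -c * u⁻¹) := by field_simp; ring
    rw [hcu, map_mul, hu, one_mul]
    exact hβ
  obtain ⟨α, hα1, hα⟩ := exists_valued_lt_one_mul_self_add_mul_eq (b := 1) (c := c + u * (β * β)) (map_one _) hy
  refine ⟨1 + 2 * α, 2 * β, ?_, ?_, ?_⟩
  · rw [add_sub_cancel_left, map_mul]; exact mul_le_of_le_one_right' hα1.le
  · rw [map_mul]; exact mul_le_of_le_one_right' hβ1
  · linear_combination (4 : K) * hα + hc4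

/-- **(W3) `u ≡ 1 (mod 4𝒪)` ⇒ EVERY UNIT IS A NORM FROM `K(√u)`** (`a(K(√u)∕K) = 0`: the unramified-or-split square classes; residue
characteristic `2`, `2 ≠ 0` in `K`, all residues squares): if `v(u − 1) ≤ v 4` and `v x = 1` then `x = a·a − u·(b·b)`.  Proof with `d = (u − 1)∕4 ∈ 𝒪`
and the norm form `a² + ab − d b²` of the order `𝒪[(1 + √u)∕2]`: if `v d < 1` then `u = r²` (★ (W-a)) and `x = ((x+1)∕2)² − (r·(x−1)∕(2r))²`; if `v d = 1`,
pick `β` with `v(β² − x∕d) < 1` (so `v β = 1`), solve `α² + βα = x + dβ²` (§0: `v(x + dβ²) = v(2x + d(β² − x∕d)) < 1` uses `v 2 < 1`), and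
`(α + β∕2)² − u(β∕2)² = α² + αβ − dβ² = x`.  This is the ⇐ half of «`a = 0 ⟺ u ∈ (1 + 4𝒪)(K^×)²`» (O'Meara 63:3: the unit of quadratic defect `4𝒪`
gives the unramified quadratic extension, all of whose units are norms). [cite: Omeara1963, §63A 63:3; §63B 63:11a] [cite: Serre1979, Ch. V §3; Ch. XIV §4] -/
theorem exists_sq_sub_mul_sq_eq_of_valued_eq_one [IsAdicComplete 𝓂[K] 𝒪[K]] (h2 : (2 : K) ≠ 0) (h2v : Valued.v (2 : K) < 1)
    (hres : ∀ z : K, Valued.v z ≤ 1 → ∃ y : K, Valued.v y ≤ 1 ∧ Valued.v (y * y - z) < 1)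
    {u : K} (hu : Valued.v (u - 1) ≤ Valued.v (4 : K)) {x : K} (hx : Valued.v x = 1) :
    ∃ a b : K, a * a - u * (b * b) = x := by
  have h4 : (4 : K) ≠ 0 := by rw [show (4 : K) = 2 * 2 by norm_num]; exact mul_ne_zero h2 h2
  have hv4 : Valued.v (4 : K) ≠ 0 := (Valuation.ne_zero_iff _).2 h4
  have hv2 : Valued.v (2 : K) ≠ 0 := (Valuation.ne_zero_iff _).2 h2
  have hv4lt : Valued.v (4 : K) < 1 := by rw [show (4 : K) = 2 * 2 by norm_num, map_mul]; exact mul_lt_one' h2v h2v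
  have hx0 : x ≠ 0 := fun h => zero_ne_one (by rw [h, map_zero] at hx; exact hx)
  -- `d := (u − 1)∕4 ∈ 𝒪`
  set d : K := (u - 1) * (4 : K)⁻¹ with hd
  have hd4 : d * 4 = u - 1 := by rw [hd, inv_mul_cancel_right₀ h4]
  have hud : u = 1 + 4 * d := by linear_combination -hd4
  have hvd : Valued.v d ≤ 1 := by
    have h := mul_le_mul_left hu (Valued.v (4 : K))⁻¹
    rwa [← map_inv₀, ← map_mul, ← hd, map_inv₀, mul_inv_cancel₀ hv4] at h
  rcases hvd.lt_or_eq with hdlt | hdeq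
  · -- `v d < 1`: `u` is a square `r·r`, the form is hyperbolic
    have hu' : Valued.v (u - 1) < Valued.v (4 : K) := by
      rw [← hd4, map_mul]
      calc Valued.v d * Valued.v (4 : K) < 1 * Valued.v (4 : K) := mul_lt_mul_of_pos_right hdlt (zero_lt_iff.2 hv4)
        _ = Valued.v (4 : K) := one_mul _
    obtain ⟨r, hr, -⟩ := exists_mul_self_eq_of_valued_sub_one_lt_four u hu'
    have hr0 : r ≠ 0 := by
      rintro rfl
      rw [← hr, mul_zero, zero_sub, Valuation.map_neg, map_one] at hu'
      exact (lt_irrefl _) (hv4lt.trans hu')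
    refine ⟨(x + 1) * (2 : K)⁻¹, (x - 1) * (2 * r)⁻¹, ?_⟩
    rw [← hr]; field_simp; ring
  · -- `v d = 1`: Hensel in `a` for the form `a² + ab − d b²`
    have hd0 : d ≠ 0 := fun h => zero_ne_one (by rw [h, map_zero] at hdeq; exact hdeq)
    have hxd : Valued.v (x * d⁻¹) = 1 := by rw [map_mul, map_inv₀, hx, hdeq, inv_one, mul_one]
    obtain ⟨β, hβ1, hβ⟩ := hres (x * d⁻¹) hxd.le
    have hβu : Valued.v β = 1 := by
      have hsq : Valued.v (β * β) = 1 := by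
        have h := Valuation.map_add_eq_of_lt_left Valued.v (x := x * d⁻¹) (y := β * β - x * d⁻¹) (by rw [hxd]; exact hβ)
        rwa [add_sub_cancel, hxd] at h
      refine hβ1.lt_or_eq.resolve_left fun hlt => (lt_irrefl (1 : ℤᵐ⁰)) ?_
      calc (1 : ℤᵐ⁰) = Valued.v β * Valued.v β := by rw [← map_mul, hsq]
        _ < 1 := mul_lt_one' hlt hlt
    have hc : Valued.v (x + d * (β * β)) < 1 := by
      have hre : x + d * (β * β) = 2 * x + d * (β * β - x * d⁻¹) := by field_simp; ring
      rw [hre]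
      refine Valuation.map_add_lt _ ?_ ?_
      · rw [map_mul, hx, mul_one]; exact h2v
      · rw [map_mul, hdeq, one_mul]; exact hβ
    obtain ⟨α, -, hα⟩ := exists_valued_lt_one_mul_self_add_mul_eq hβu hc
    refine ⟨α + β * (2 : K)⁻¹, β * (2 : K)⁻¹, ?_⟩
    rw [hud]; field_simp; linear_combination (4 : K) * hα

/-- **(W3′) square-class form**: if `v(u − 1) ≤ v 4` then every unit is a norm from `K(√(u·t²))` for every `t ≠ 0` (§1 transport + (W3)) — every
`u′ ∈ (1 + 4𝒪)·(K^×)²` has `a(K(√u′)∕K) = 0`. [cite: Omeara1963, §63A 63:3; §63B 63:11a] -/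
theorem exists_sq_sub_mul_sq_eq_of_valued_eq_one_of_mul_sq [IsAdicComplete 𝓂[K] 𝒪[K]] (h2 : (2 : K) ≠ 0) (h2v : Valued.v (2 : K) < 1)
    (hres : ∀ z : K, Valued.v z ≤ 1 → ∃ y : K, Valued.v y ≤ 1 ∧ Valued.v (y * y - z) < 1)
    {u : K} (hu : Valued.v (u - 1) ≤ Valued.v (4 : K)) {t : K} (ht : t ≠ 0) {x : K} (hx : Valued.v x = 1) :
    ∃ a b : K, a * a - u * (t * t) * (b * b) = x :=
  (exists_sq_sub_mul_sq_iff_mul_sq u ht x).1 (exists_sq_sub_mul_sq_eq_of_valued_eq_one h2 h2v hres hu hx)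

/-- **(W4) THE EVEN-DEPTH LADDER** (O'Meara 63:2∕63:5; no completeness needed): if `u − 1` has the EVEN depth of `y²`, `v(u − 1) = v(y)·v(y) < 1`,
with `v 2 < v y` (depth `2k`, `k < ord 2`), then `v(u·t² − 1) < v(u − 1)` for some unit `t`: take `z = (u − 1)∕y²` (a unit), `γ ∈ 𝒪` with
`v(γ² − z) < 1` (hres), `t = (1 + yγ)⁻¹`; then `u − (1 + yγ)² = y²(z − γ²) − 2yγ` and both terms are deeper than `y²` (the second because `v 2 < v y`).
Hence a unit's square class is either `≥ 4`-deep (then (W3): unramified or split) or has an ODD depth `s < 2·ord 2` — its quadratic defect `𝔭^s`.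
[cite: Omeara1963, §63A 63:2, 63:5] -/
theorem exists_valued_mul_sq_sub_one_lt
    (hres : ∀ z : K, Valued.v z ≤ 1 → ∃ y : K, Valued.v y ≤ 1 ∧ Valued.v (y * y - z) < 1)
    {u y : K} (hu1 : Valued.v (u - 1) < 1) (huy : Valued.v (u - 1) = Valued.v y * Valued.v y) (h2y : Valued.v (2 : K) < Valued.v y) :
    ∃ t : K, Valued.v t = 1 ∧ Valued.v (u * (t * t) - 1) < Valued.v (u - 1) := by
  have hvy0 : Valued.v y ≠ 0 := fun h => by
    rw [h] at h2y
    exact not_lt_zero h2y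
  have hy0 : y ≠ 0 := (Valuation.ne_zero_iff _).1 hvy0
  have hvy1 : Valued.v y < 1 := by
    by_contra h
    rw [not_lt] at h
    have h1 : (1 : ℤᵐ⁰) ≤ Valued.v y * Valued.v y := one_le_mul h h
    rw [← huy] at h1
    exact (lt_irrefl _) (hu1.trans_le h1)
  -- `z := (u − 1)∕y²`, a unit
  set z : K := (u - 1) * (y * y)⁻¹ with hz
  have hzy : z * (y * y) = u - 1 := by rw [hz, inv_mul_cancel_right₀ (mul_ne_zero hy0 hy0)]
  have hvz : Valued.v z = 1 := by
    rw [hz, map_mul, map_inv₀, map_mul, huy, mul_inv_cancel₀ (mul_ne_zero hvy0 hvy0)]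
  obtain ⟨γ, hγ1, hγ⟩ := hres z hvz.le
  -- `s := 1 + yγ`, a unit
  have hyγ : Valued.v (y * γ) < 1 := by rw [map_mul]; exact (mul_le_of_le_one_right' hγ1).trans_lt hvy1
  have hs : Valued.v (1 + y * γ) = 1 := by
    rw [Valuation.map_one_add_of_lt _ hyγ]
  have hs0 : 1 + y * γ ≠ 0 := (Valuation.ne_zero_iff _).1 (by rw [hs]; exact one_ne_zero)
  refine ⟨(1 + y * γ)⁻¹, by rw [map_inv₀, hs, inv_one], ?_⟩
  have key : u * ((1 + y * γ)⁻¹ * (1 + y * γ)⁻¹) - 1 =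
      (y * y * (z - γ * γ) + -(2 * (y * γ))) * ((1 + y * γ)⁻¹ * (1 + y * γ)⁻¹) := by
    have hu : u = 1 + z * (y * y) := by linear_combination -hzy
    rw [hu]
    field_simp
    ring
  rw [key, map_mul, map_mul Valued.v ((1 + y * γ)⁻¹), map_inv₀, hs, inv_one, mul_one, mul_one, huy]
  refine Valuation.map_add_lt _ ?_ ?_
  · rw [map_mul, map_mul, Valuation.map_sub_swap]
    calc Valued.v y * Valued.v y * Valued.v (γ * γ - z) < Valued.v y * Valued.v y * 1 :=
          mul_lt_mul_of_pos_left hγ (zero_lt_iff.2 (mul_ne_zero hvy0 hvy0))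
      _ = Valued.v y * Valued.v y := mul_one _
  · rw [Valuation.map_neg, map_mul, map_mul]
    calc Valued.v (2 : K) * (Valued.v y * Valued.v γ) ≤ Valued.v (2 : K) * (Valued.v y * 1) :=
          mul_le_mul_right (mul_le_mul_right hγ1 _) _
      _ = Valued.v (2 : K) * Valued.v y := by rw [mul_one]
      _ < Valued.v y * Valued.v y := mul_lt_mul_of_pos_right h2y (zero_lt_iff.2 hvy0)
end NearOne

/-! ## §6 «Every residue is a square» from a finite residue field of characteristic `2` -/
section Residue
variable {K : Type*} [Field K] [Valued K ℤᵐ⁰]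
/-- **`hres` DISCHARGED**: if the residue field `𝓀[K]` is finite and `v 2 < 1` (residue characteristic `2`) then every `z ∈ 𝒪[K]` is a square modulo `𝓂[K]`:
`∃ y, v y ≤ 1 ∧ v(y·y − z) < 1` (the Frobenius of a finite field of characteristic `2` is onto: Mathlib `isSquare_of_charTwo'`).
[cite: Serre1979, Ch. XIV §4] [cite: Omeara1963, §63A 63:1a] -/
theorem exists_valued_mul_self_sub_lt_one_of_finite_residueField [Finite 𝓀[K]] (h2v : Valued.v (2 : K) < 1) (z : K) (hz : Valued.v z ≤ 1) :
    ∃ y : K, Valued.v y ≤ 1 ∧ Valued.v (y * y - z) < 1 := by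
  have hzO : z ∈ 𝒪[K] := (Valuation.mem_integer_iff _ _).2 hz
  set zO : 𝒪[K] := ⟨z, hzO⟩ with hzO_def
  have h2M : (2 : 𝒪[K]) ∈ 𝓂[K] := by
    rw [Valued.maximalIdeal, IsLocalRing.mem_maximalIdeal, mem_nonunits_iff, Valuation.Integer.not_isUnit_iff_valuation_lt_one]
    exact_mod_cast h2v
  haveI : CharP 𝓀[K] 2 := by
    refine CharTwo.of_one_ne_zero_of_two_eq_zero one_ne_zero ?_
    have h := (IsLocalRing.residue_eq_zero_iff (2 : 𝒪[K])).2 h2M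
    rwa [map_ofNat] at h
  obtain ⟨r, hr⟩ := isSquare_of_charTwo' (IsLocalRing.residue 𝒪[K] zO)
  obtain ⟨yO, rfl⟩ := IsLocalRing.residue_surjective r
  refine ⟨yO, yO.2, ?_⟩
  have hmem : yO * yO - zO ∈ 𝓂[K] := by
    rw [Valued.maximalIdeal, ← IsLocalRing.residue_eq_zero_iff, map_sub, map_mul, ← hr, sub_self]
  rw [Valued.maximalIdeal, IsLocalRing.mem_maximalIdeal, mem_nonunits_iff, Valuation.Integer.not_isUnit_iff_valuation_lt_one] at hmem
  exact_mod_cast hmem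

/-- (W2) with `hres` discharged: finite residue field, `v 2 < 1`, `v u = 1`, `v(x − 1) ≤ v 4 ⇒ x = a·a − u·(b·b)` with `v(a − 1) ≤ v 2`, `v b ≤ v 2`
(`a(K(√u)∕K) ≤ 2·ord 2` for every unit `u` of a `2`-adically complete field with finite residue field). [cite: Omeara1963, §63A 63:2–63:5; §63B 63:11a] -/
theorem exists_sq_sub_mul_sq_eq_of_valued_sub_one_le_four_of_finite_residueField [IsAdicComplete 𝓂[K] 𝒪[K]] [Finite 𝓀[K]]
    (h2v : Valued.v (2 : K) < 1) {u : K} (hu : Valued.v u = 1) {x : K} (hx : Valued.v (x - 1) ≤ Valued.v (4 : K)) :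
    ∃ a b : K, Valued.v (a - 1) ≤ Valued.v (2 : K) ∧ Valued.v b ≤ Valued.v (2 : K) ∧ a * a - u * (b * b) = x :=
  exists_sq_sub_mul_sq_eq_of_valued_sub_one_le_four (exists_valued_mul_self_sub_lt_one_of_finite_residueField h2v) hu hx

/-- (W3) with `hres` discharged: finite residue field, `v 2 < 1`, `2 ≠ 0`, `v(u − 1) ≤ v 4`, `v x = 1 ⇒ x = a·a − u·(b·b)` (`a(K(√u)∕K) = 0`).
[cite: Omeara1963, §63A 63:3; §63B 63:11a] -/
theorem exists_sq_sub_mul_sq_eq_of_valued_eq_one_of_finite_residueField [IsAdicComplete 𝓂[K] 𝒪[K]] [Finite 𝓀[K]]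
    (h2 : (2 : K) ≠ 0) (h2v : Valued.v (2 : K) < 1) {u : K} (hu : Valued.v (u - 1) ≤ Valued.v (4 : K)) {x : K} (hx : Valued.v x = 1) :
    ∃ a b : K, a * a - u * (b * b) = x :=
  exists_sq_sub_mul_sq_eq_of_valued_eq_one h2 h2v (exists_valued_mul_self_sub_lt_one_of_finite_residueField h2v) hu hx
end Residue

/-! ## §7 The completion `F_v` of a number field at a dyadic place -/
section AdicCompletion
variable (F : Type*) [Field F] [NumberField F] (v : HeightOneSpectrum (𝓞 F))
/-- **(W2) AT A DYADIC PLACE `v` OF A NUMBER FIELD** (`v(2) < 1` in `F_v`): for a unit `u ∈ F_v` and `x` with `v(x − 1) ≤ v 4`, `x = a·a − u·(b·b)` with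
`v(a − 1) ≤ v 2`, `v b ≤ v 2` — `1 + 4𝒪_v ⊆ N(F_v(√u)^×)`, i.e. `a(F_v(√u)∕F_v) ≤ 2·ord_v 2`.  Instance data: ★ `isAdicComplete_valuedMaximalIdeal_valuedInteger_adicCompletion`,
★ `finite_residueField_adicCompletion`. [cite: Omeara1963, §63A 63:2–63:5; §63B 63:11a] [cite: Serre1979, Ch. XV §2] -/
theorem exists_sq_sub_mul_sq_eq_of_valued_sub_one_le_four_adicCompletion (h2v : Valued.v (2 : v.adicCompletion F) < 1)
    {u : v.adicCompletion F} (hu : Valued.v u = 1) {x : v.adicCompletion F} (hx : Valued.v (x - 1) ≤ Valued.v (4 : v.adicCompletion F)) :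
    ∃ a b : v.adicCompletion F, Valued.v (a - 1) ≤ Valued.v (2 : v.adicCompletion F) ∧ Valued.v b ≤ Valued.v (2 : v.adicCompletion F) ∧
      a * a - u * (b * b) = x := by
  haveI := Literature.NumberTheory.Automorphic.isAdicComplete_valuedMaximalIdeal_valuedInteger_adicCompletion F v
  haveI : Finite 𝓀[v.adicCompletion F] := Literature.NumberTheory.Automorphic.finite_residueField_adicCompletion F v
  exact exists_sq_sub_mul_sq_eq_of_valued_sub_one_le_four_of_finite_residueField h2v hu hx

/-- **(W3) AT A DYADIC PLACE `v` OF A NUMBER FIELD**: `v(u − 1) ≤ v 4` and `v x = 1 ⇒ x = a·a − u·(b·b)` in `F_v` — every unit of `F_v` is a norm from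
`F_v(√u)` when `u ≡ 1 (mod 4𝒪_v)` (`a = 0`). [cite: Omeara1963, §63A 63:3; §63B 63:11a] [cite: Serre1979, Ch. V §3] -/
theorem exists_sq_sub_mul_sq_eq_of_valued_eq_one_adicCompletion (h2v : Valued.v (2 : v.adicCompletion F) < 1)
    {u : v.adicCompletion F} (hu : Valued.v (u - 1) ≤ Valued.v (4 : v.adicCompletion F)) {x : v.adicCompletion F} (hx : Valued.v x = 1) :
    ∃ a b : v.adicCompletion F, a * a - u * (b * b) = x := by
  haveI := Literature.NumberTheory.Automorphic.isAdicComplete_valuedMaximalIdeal_valuedInteger_adicCompletion F v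
  haveI : Finite 𝓀[v.adicCompletion F] := Literature.NumberTheory.Automorphic.finite_residueField_adicCompletion F v
  have h2 : (2 : v.adicCompletion F) ≠ 0 := by
    rw [show (2 : v.adicCompletion F) = algebraMap F (v.adicCompletion F) 2 by rw [map_ofNat]]
    exact (_root_.map_ne_zero (algebraMap F (v.adicCompletion F))).2 two_ne_zero
  exact exists_sq_sub_mul_sq_eq_of_valued_eq_one_of_finite_residueField h2 h2v hu hx

/-- **(W4) AT A DYADIC PLACE `v` OF A NUMBER FIELD**: the even-depth ladder in `F_v` — `v(u − 1) = v(y)² < 1`, `v 2 < v y ⇒ v(u·t² − 1) < v(u − 1)` for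
some unit `t`. [cite: Omeara1963, §63A 63:2, 63:5] -/
theorem exists_valued_mul_sq_sub_one_lt_adicCompletion (h2v : Valued.v (2 : v.adicCompletion F) < 1)
    {u y : v.adicCompletion F} (hu1 : Valued.v (u - 1) < 1) (huy : Valued.v (u - 1) = Valued.v y * Valued.v y)
    (h2y : Valued.v (2 : v.adicCompletion F) < Valued.v y) :
    ∃ t : v.adicCompletion F, Valued.v t = 1 ∧ Valued.v (u * (t * t) - 1) < Valued.v (u - 1) := by
  haveI : Finite 𝓀[v.adicCompletion F] := Literature.NumberTheory.Automorphic.finite_residueField_adicCompletion F v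
  exact exists_valued_mul_sq_sub_one_lt (exists_valued_mul_self_sub_lt_one_of_finite_residueField h2v) hu1 huy h2y
end AdicCompletion

end Literature.NumberTheory.LocalFields

end
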